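import Mathlib
import Literature.NumberTheory.Transcendental.PeriodsWave0
import Literature.NumberTheory.Irrationality.RivoalZudilin2020.TwoIrrationalOddZetaValues
import HarnessLib

/-!
# Krattenthaler–Zudilin (2019): collections `ζ(2m+1) − λ·c_m·π^{2m+1}` contain an irrational number;
# the hypergeometric approximations to `G`, `π²`, `π⁴` of the paper

Topic `Literature/NumberTheory/Irrationality/KrattenthalerZudilin2019`. Source: C. Krattenthaler,
W. Zudilin, *Hypergeometry inspired by irrationality questions*, Kyushu J. Math. **73** (2019) 189–203 =
arXiv:1802.08856 [KrattenthalerZudilin2019]. READ ON THE PAGE: held text `paper:arxiv-1802.08856`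
(§1 Theorem 1 = chunk p0003; §2 = p0005; §4 Lemma 1 and eq. (8) = p0007; §5 proof of Theorem 1 = p0010),
with every display below transcribed from the arXiv LaTeX source (`catagain2018-08-05.tex`: Theorem 1 =
lines 100–112, the "Notice that" remark = lines 115–119, §2 = lines 136–181, §4 = lines 421–455 and 551–563).
Equation numbers are those of the arXiv version (global numbering: (1) = Theorem 2, (2) = Theorem 3,
(8) = the `₅F₄ = ₃F₂` identity of §4, (9) = Theorem 4).

## What is typed (named facts, statements only — `def … : Prop`, no proof claimed here)

* `theorem1` — **Theorem 1** (§1, p. 190 of the journal; proved in §5): for every real `λ`, each of the two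
  collections `{ζ(2m+1) − λ·coeffOne m·π^{2m+1} : m = 1,…,19}` and
  `{ζ(2m+1) − λ·coeffTwo m·π^{2m+1} : m = 1,…,21}` contains at least one irrational number, where
  `coeffOne m = 2^{2m}(2^{2m+2}−1)|B_{2m+2}| / ((2^{2m+1}−1)(m+1)(2m)!)` and
  `coeffTwo m = 2^{2m}(2^{2m}−1)|B_{2m}| / ((2^{2m+1}−1)m(2m)!)` (`B_k` = Mathlib's `bernoulli k`; for even
  `k ≥ 2` the two Bernoulli conventions agree).
* `catalanR_eq_catalanRTilde` — §2: the Rivoal–Zudilin (2003) very-well-poised approximations `r_n` to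
  Catalan's constant `G` coincide with the new family `r̃_n` ("Amazingly, we have `r_n = r̃_n`"; the case
  `c = d = n + ½` of Theorem 2, eq. (1)).
* `catalanRTilde_integrality` — §2: `2^{4n} d_{2n−1}^2 r̃_n ∈ ℤ + ℤG` (`d_N = lcm(1,…,N)` = `Nat.lcmUpto N`).
  CAVEAT (recorded, not softened): the paper ASSERTS this ("it is reasonably easy to show that … using an
  argument similar to the one in [Zu02b]") without a written proof.
* `rFour_eq_hypergeometric` — §4, eq. (8) combined with the definition of `r_n`: the well-poised sum
  `r_n = Σ_{t ≥ 1} R_n(t)`, `R_n(t) = 2^{8n} n!⁴ (2n)!² ∏_{j=0}^{4n−1}(t−n+j) / ((4n)! ∏_{j=0}^{2n}(t−½+j)⁴)`,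
  equals `π² (2n)!⁴/(4n+1)!² · ₃F₂(2n+1, 2n+1, 2n+1; 4n+2, 4n+2; 1)` (a "rarified" Apéry sequence for `ζ(2)`).
* `rFour_mem_span` — §4: `r_n = a_n π⁴ − b_n π²` with rational `a_n, b_n` for all `n` (the `ℚ·1` part
  vanishes: the cancellation phenomenon of Lemma 1); `rFour_one` — `r_1 = 19π⁴/6 − 125π²/4`.

## What is PROVED here

* (private helpers `zetaValue_two_mul` — Euler's formula via Mathlib's `hasSum_zeta_nat` —,
  `zetaValue_two_mul_pos`, `abs_bernoulli_two_mul` — the sign of `B_{2k}` from `ζ(2k) > 0`) and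
  `remark` — the "Notice that" display of §1: `2^{2m−1}|B_{2m}|/(2m)! = ζ(2m)/π^{2m}`;
* `coeffOne_mul_pi_pow`, `coeffTwo_mul_pi_pow` — the shifts are rational multiples of `ζ(2m+2)/π`, resp.
  `ζ(2m)·π`: `coeffOne m·π^{2m+1} = (2m+1)(2^{2m+2}−1)/(2^{2m+1}−1) · ζ(2m+2)/π` and
  `coeffTwo m·π^{2m+1} = 2(2^{2m}−1)/((2^{2m+1}−1)m) · ζ(2m)·π` (this is how they arise in §5 from the
  linear forms `r_n − (λ/π) r_n'`, `r̂_n' − 4λπ r̂_n`); `coeffOne_one = 1/14`, `coeffTwo_one = 1/7`;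
* `catalanR_zero : r_0 = 8G`, `catalanRTilde_zero : r̃_0 = 8G` (hence `r_0 = r̃_0` and the integrality claim at
  `n = 0`: `catalanR_eq_catalanRTilde_zero`, `catalanRTilde_integrality_zero`), `rFour_zero : r_0 = π⁴/6`;
* the whole of **Lemma 1** (see the section below).

Transcription checks (seat folder `scratch/kz_check.py`, floats/exact rationals): `coeffOne 1 = 1/14`,
`coeffTwo 1 = 1/7`; the remark for `m = 1,2,3`; both `coeff…_mul_pi_pow` relations for `m = 1,2,5`;
`r_n = r̃_n` for `n = 0,1,2` (to `10⁻¹¹`), `r_0 = 8G`; eq. (8) for `n = 0,1,2` and `r_1 = 19π⁴/6 − 125π²/4`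
(`0.0369840736…`).

NOT typed: Theorems 2, 3, 4 (generic `₆F₅(−1) = Γ-ratio·₆F₅(1)`, `₂F₁(−1) = Γ-ratio·₃F₂(1)`,
`₃F₂(1) = Γ-ratio·₅F₄(1)` transformations, eqs. (1), (2), (9)) and their `q`-versions — the tree has no
vocabulary for generalized hypergeometric series `ₚF_q` at unit argument and the paper prints no convergence
hypotheses; §3 (`log 2`: the `₂F₁(−1)`/`₃F₂(1)` coincidence, the `𝔊`-orbit bookkeeping (3)–(7)); the
comparison collections `m ≤ 169` attributed to [HP06, Theorems 3 and 4] (Hessami Pilehrood, Math. Notes 79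
(2006)) are typed ONLY as restated in §1 of the source (`hessamiPilehrood2006_collections`, both cited; the primary
is paywalled, acq-12890), with the proved readings `hpCoeffOne_mul_pi_pow`, `hpCoeffTwo_mul_pi_pow`.

## Lemma 1 (§4, the half-integer cancellation lemma) — PROVED (namespace `Lemma1`)

For `R(t) = Σ_{i=1}^{s} Σ_{k=0}^{n} a_{i,k}(t+k)^{−i}` (`Lemma1.R`): `coeffSymm_iff_reflect` — `R(t) = R(−n−t)`
off the poles iff `a_{i,n−k} = (−1)^i a_{i,k}` (the first assertion of Lemma 1, via the uniqueness of
partial-fraction coefficients `coeff_eq_zero_of_R_eq_zero`); `lemma1` — under this symmetry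
`Σ_{t=−m}^{∞} R(t − ½) = Σ_{i even} a_i (2^i−1)ζ(i) + a_0`, `m = ⌊(n−1)/2⌋`, `a_i = Σ_k a_{i,k}`, `a_0 = 0`
(`n` even), `a_0 = ½R(−m−½)` (`n` odd), as the limit of the partial sums over the sample points
`firstPoint n + t` (`firstPoint n = −m − ½ = −n/2` or `−n/2 + ½`); parity versions `tendsto_partialSum_odd`,
`tendsto_partialSum_even`; tools `R_reflect`, `tendsto_Hp` (and private window lemmas `sum_window`,
`tendsto_window`, `sum_R_window`).
(The closing membership `∈ ℚ + ℚπ² + … + ℚπ^{2⌊s/2⌋}` for rational `a_{i,k}` is Euler's `ζ(2j) ∈ ℚπ^{2j}`,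
cf. `remark`; not restated.)

`ζ(k) = zetaValue k` and `G = catalanConstant` are the tree's (`PeriodsWave0`).
WHAT THIS IS NOT: nothing here isolates `ζ(5)`; Theorem 1 concerns `ζ(2m+1)` shifted by multiples of
`π^{2m+1}`.
-/

noncomputable section

open Finset Filter Topology

open scoped Nat

namespace Literature.NumberTheory.Irrationality.KrattenthalerZudilin2019

open Literature.NumberTheory.Transcendental (zetaValue catalanConstant)
open Literature.NumberTheory.Irrationality.RivoalZudilin2020 (zetaHat_eq)

/-! ## §1 — Theorem 1 -/

/-- The coefficient of the first collection of Theorem 1: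
`2^{2m}(2^{2m+2}−1)|B_{2m+2}| / ((2^{2m+1}−1)(m+1)(2m)!)`. [cite: KrattenthalerZudilin2019, Theorem 1] -/
def coeffOne (m : ℕ) : ℝ :=
  2 ^ (2 * m) * (2 ^ (2 * m + 2) - 1) * |((bernoulli (2 * m + 2) : ℚ) : ℝ)| /
    ((2 ^ (2 * m + 1) - 1) * (m + 1) * (2 * m)!)

/-- The coefficient of the second collection of Theorem 1:
`2^{2m}(2^{2m}−1)|B_{2m}| / ((2^{2m+1}−1)m(2m)!)`. [cite: KrattenthalerZudilin2019, Theorem 1] -/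
def coeffTwo (m : ℕ) : ℝ :=
  2 ^ (2 * m) * (2 ^ (2 * m) - 1) * |((bernoulli (2 * m) : ℚ) : ℝ)| /
    ((2 ^ (2 * m + 1) - 1) * m * (2 * m)!)

/-- **Theorem 1** (Krattenthaler–Zudilin 2019), as printed: "For any `λ ∈ ℝ`, each of the two collections
`{ζ(2m+1) − λ·2^{2m}(2^{2m+2}−1)|B_{2m+2}|/((2^{2m+1}−1)(m+1)(2m)!)·π^{2m+1} : m = 1, 2, …, 19}` and
`{ζ(2m+1) − λ·2^{2m}(2^{2m}−1)|B_{2m}|/((2^{2m+1}−1)m(2m)!)·π^{2m+1} : m = 1, 2, …, 21}`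
contains at least one irrational number. Here `B_{2m}` denotes the `2m`-th Bernoulli number."
Named fact (statement only; proved in §5 of the source from Zudilin's 2018 construction and Lemma 1).
[cite: KrattenthalerZudilin2019, Theorem 1 (§1; proof §5)] -/
def theorem1 : Prop :=
  ∀ l : ℝ,
    (∃ m : ℕ, 1 ≤ m ∧ m ≤ 19 ∧
        Irrational (zetaValue (2 * m + 1) - l * coeffOne m * Real.pi ^ (2 * m + 1))) ∧
      ∃ m : ℕ, 1 ≤ m ∧ m ≤ 21 ∧
        Irrational (zetaValue (2 * m + 1) - l * coeffTwo m * Real.pi ^ (2 * m + 1))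

/-- Euler's formula in the tree's notation: `ζ(2k) = (−1)^{k+1} 2^{2k−1} π^{2k} B_{2k}/(2k)!` (`k ≠ 0`;
Mathlib's `hasSum_zeta_nat`). [folklore] -/
private theorem zetaValue_two_mul {k : ℕ} (hk : k ≠ 0) :
    zetaValue (2 * k) =
      (-1) ^ (k + 1) * 2 ^ (2 * k - 1) * Real.pi ^ (2 * k) * ((bernoulli (2 * k) : ℚ) : ℝ) /
        (2 * k)! := by
  rw [zetaValue, (hasSum_zeta_nat hk).tsum_eq]

/-- `ζ(2k) > 0` for `k ≠ 0`. [folklore] -/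
private theorem zetaValue_two_mul_pos {k : ℕ} (hk : k ≠ 0) : 0 < zetaValue (2 * k) := by
  have hs : Summable (fun n : ℕ => 1 / (n : ℝ) ^ (2 * k)) := (hasSum_zeta_nat hk).summable
  refine hs.tsum_pos (fun n => by positivity) 1 ?_
  simp

/-- The sign of the even-index Bernoulli numbers, `|B_{2k}| = (−1)^{k+1} B_{2k}` (`k ≠ 0`), read off from
`ζ(2k) > 0`. [folklore] -/
private theorem abs_bernoulli_two_mul {k : ℕ} (hk : k ≠ 0) :
    |((bernoulli (2 * k) : ℚ) : ℝ)| = (-1) ^ (k + 1) * ((bernoulli (2 * k) : ℚ) : ℝ) := by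
  have h := zetaValue_two_mul_pos hk
  rw [zetaValue_two_mul hk] at h
  have hc : (0 : ℝ) < 2 ^ (2 * k - 1) * Real.pi ^ (2 * k) / (2 * k)! := by positivity
  have hs : 0 < (-1) ^ (k + 1) * ((bernoulli (2 * k) : ℚ) : ℝ) := by
    have : (-1) ^ (k + 1) * 2 ^ (2 * k - 1) * Real.pi ^ (2 * k) * ((bernoulli (2 * k) : ℚ) : ℝ) /
        (2 * k)! = ((-1) ^ (k + 1) * ((bernoulli (2 * k) : ℚ) : ℝ)) *
          (2 ^ (2 * k - 1) * Real.pi ^ (2 * k) / (2 * k)!) := by ring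
    rw [this] at h
    exact pos_of_mul_pos_left h hc.le
  rcases neg_one_pow_eq_or ℝ (k + 1) with h1 | h1 <;> rw [h1] at hs ⊢
  · rw [one_mul] at hs ⊢
    exact abs_of_pos hs
  · rw [neg_one_mul] at hs ⊢
    exact abs_of_neg (neg_pos.mp hs)

/-- The "Notice that" remark after Theorem 1: `2^{2m−1}|B_{2m}|/(2m)! = ζ(2m)/π^{2m} ∈ ℚ` for
`m = 1, 2, …`. [cite: KrattenthalerZudilin2019, §1 (display after Theorem 1)] -/
theorem remark {m : ℕ} (hm : m ≠ 0) :
    (2 : ℝ) ^ (2 * m - 1) * |((bernoulli (2 * m) : ℚ) : ℝ)| / (2 * m)! =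
      zetaValue (2 * m) / Real.pi ^ (2 * m) := by
  rw [abs_bernoulli_two_mul hm, zetaValue_two_mul hm]
  have hpi : Real.pi ^ (2 * m) ≠ 0 := pow_ne_zero _ Real.pi_ne_zero
  field_simp

/-- The first shift is a rational multiple of `ζ(2m+2)/π`:
`coeffOne m · π^{2m+1} = (2m+1)(2^{2m+2}−1)/(2^{2m+1}−1) · ζ(2m+2)/π` (this is the combination
`(2^i−1)ζ(i) − μ·i(2^{i+1}−1)ζ(i+1)`, `i = 2m+1`, `μ = λ/π`, of the linear forms `r_n − μ r_n'` in §5).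
[cite: KrattenthalerZudilin2019, §5 (proof of Theorem 1)] -/
theorem coeffOne_mul_pi_pow (m : ℕ) :
    coeffOne m * Real.pi ^ (2 * m + 1) =
      (2 * m + 1) * (2 ^ (2 * m + 2) - 1) / (2 ^ (2 * m + 1) - 1) * zetaValue (2 * m + 2) / Real.pi := by
  have hk : m + 1 ≠ 0 := Nat.succ_ne_zero m
  have hz := zetaValue_two_mul hk
  have hb := abs_bernoulli_two_mul hk
  rw [show 2 * (m + 1) = 2 * m + 2 by ring] at hz hb
  rw [show 2 * m + 2 - 1 = 2 * m + 1 from rfl] at hz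
  rw [coeffOne, hb, hz]
  have hpi : Real.pi ≠ 0 := Real.pi_ne_zero
  have h2 : (2 : ℝ) ^ (2 * m + 1) - 1 ≠ 0 := by
    have : (2 : ℝ) ≤ 2 ^ (2 * m + 1) := by
      calc (2 : ℝ) = 2 ^ 1 := (pow_one _).symm
        _ ≤ 2 ^ (2 * m + 1) := pow_le_pow_right₀ (by norm_num) (by omega)
    linarith
  have hf : ((2 * m + 2)! : ℝ) = (2 * m + 2) * (2 * m + 1) * (2 * m)! := by
    rw [Nat.factorial_succ (2 * m + 1), Nat.factorial_succ (2 * m)]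
    push_cast
    ring
  rw [hf]
  have hm1 : ((m : ℝ) + 1) ≠ 0 := by positivity
  have hfac : ((2 * m)! : ℝ) ≠ 0 := by positivity
  field_simp
  ring

/-- The second shift is a rational multiple of `ζ(2m)·π` (`m ≠ 0`):
`coeffTwo m · π^{2m+1} = 2(2^{2m}−1)/((2^{2m+1}−1)m) · ζ(2m)·π` (the combination
`i(2^{i+1}−1)ζ(i+1) − 4λπ(2^i−1)ζ(i)`, `i = 2m`, of the linear forms `r̂_n' − 4λπ r̂_n` in §5).
[cite: KrattenthalerZudilin2019, §5 (proof of Theorem 1)] -/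
theorem coeffTwo_mul_pi_pow {m : ℕ} (hm : m ≠ 0) :
    coeffTwo m * Real.pi ^ (2 * m + 1) =
      2 * (2 ^ (2 * m) - 1) / ((2 ^ (2 * m + 1) - 1) * m) * zetaValue (2 * m) * Real.pi := by
  have hz := zetaValue_two_mul hm
  have hb := abs_bernoulli_two_mul hm
  rw [coeffTwo, hb, hz]
  have hpi : Real.pi ≠ 0 := Real.pi_ne_zero
  have h2 : (2 : ℝ) ^ (2 * m + 1) - 1 ≠ 0 := by
    have : (2 : ℝ) ≤ 2 ^ (2 * m + 1) := by
      calc (2 : ℝ) = 2 ^ 1 := (pow_one _).symm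
        _ ≤ 2 ^ (2 * m + 1) := pow_le_pow_right₀ (by norm_num) (by omega)
    linarith
  have hmR : (m : ℝ) ≠ 0 := by exact_mod_cast hm
  have hfac : ((2 * m)! : ℝ) ≠ 0 := by positivity
  have hpow : (2 : ℝ) ^ (2 * m) = 2 * 2 ^ (2 * m - 1) := by
    rw [← pow_succ']
    congr 1
    omega
  rw [pow_succ, hpow]
  field_simp
  ring

/-- Sanity value: the `m = 1` shift of the first collection is `π³/14`
(`B₄ = −1/30`: `coeffOne 1 = 4·15·(1/30)/(7·2·2) = 1/14`). [cite: KrattenthalerZudilin2019, Theorem 1] -/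
theorem coeffOne_one : coeffOne 1 = 1 / 14 := by
  rw [coeffOne, show 2 * 1 + 2 = 4 by rfl, bernoulli_eq_bernoulli'_of_ne_one (by norm_num),
    bernoulli'_four]
  norm_num [Nat.factorial]

/-- Sanity value: the `m = 1` shift of the second collection is `π³/7`
(`B₂ = 1/6`: `coeffTwo 1 = 4·3·(1/6)/(7·1·2) = 1/7`). [cite: KrattenthalerZudilin2019, Theorem 1] -/
theorem coeffTwo_one : coeffTwo 1 = 1 / 7 := by
  rw [coeffTwo, show 2 * 1 = 2 by rfl, bernoulli_eq_bernoulli'_of_ne_one (by norm_num),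
    bernoulli'_two]
  norm_num [Nat.factorial]

/-! ## §2 — Catalan's constant: `r_n = r̃_n` -/

/-- The Rivoal–Zudilin (2003) very-well-poised approximations to Catalan's constant, as displayed in §2:
`r_n = Σ_{t ≥ 0} (2t+n+1) · n! ∏_{j=1}^{n}(t+1−j) ∏_{j=1}^{n}(t+n+j) / ∏_{j=0}^{n}(t+j+½)³ · (−1)^{n+t}`
(a `₆F₅(−1)`-series). [cite: KrattenthalerZudilin2019, §2 (first display)] -/
def catalanR (n : ℕ) : ℝ :=
  ∑' t : ℕ, (2 * (t : ℝ) + n + 1) * (n ! : ℝ) * (∏ j ∈ range n, ((t : ℝ) - j)) *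
      (∏ j ∈ range n, ((t : ℝ) + n + 1 + j)) / (∏ j ∈ range (n + 1), ((t : ℝ) + j + 1 / 2) ^ 3) *
    (-1) ^ (n + t)

/-- The new family of §2 (a very-well-poised `₆F₅(1)`-series), written over `u = t − 1 ≥ 0`:
`r̃_n = 2^{2(n+1)} Σ_{t ≥ 1} (2t−1) (2n+1)! ∏_{j=0}^{2n−1}(t−n+j) / ∏_{j=0}^{2n+1}(2t−n−3/2+j)²`.
[cite: KrattenthalerZudilin2019, §2 (second display)] -/
def catalanRTilde (n : ℕ) : ℝ :=
  2 ^ (2 * (n + 1)) * ∑' u : ℕ, (2 * (u : ℝ) + 1) * ((2 * n + 1)! : ℝ) *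
    (∏ j ∈ range (2 * n), ((u : ℝ) + 1 - n + j)) /
      ∏ j ∈ range (2 * n + 2), (2 * (u : ℝ) - n + 1 / 2 + j) ^ 2

/-- §2: "Amazingly, we have `r_n = r̃_n`" — the two families of approximations to Catalan's constant coincide
(the case `c = d = n + ½` of Theorem 2, eq. (1)). Named fact (statement only).
[cite: KrattenthalerZudilin2019, §2 and Theorem 2] -/
def catalanR_eq_catalanRTilde : Prop :=
  ∀ n : ℕ, catalanR n = catalanRTilde n

/-- §2: `2^{4n} d_{2n−1}^2 r̃_n ∈ ℤ + ℤ·G`, `d_N = lcm(1, …, N)` (`Nat.lcmUpto`), `G` = Catalan's constant.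
CAVEAT: asserted in print with the proof indicated only by reference ("it is reasonably easy to show that
… using an argument similar to the one in [Zu02b]" = Zudilin, Chebyshevskiĭ Sb. 3:2 (2002) 60–70); typed
verbatim, not strengthened. Named fact (statement only).
[cite: KrattenthalerZudilin2019, §2 (sentence after the second display)] -/
def catalanRTilde_integrality : Prop :=
  ∀ n : ℕ, ∃ A B : ℤ,
    (2 : ℝ) ^ (4 * n) * (Nat.lcmUpto (2 * n - 1) : ℝ) ^ 2 * catalanRTilde n = A + B * catalanConstant

/-- `r_0 = 8G`: at `n = 0` the first family is `Σ_{t ≥ 0} (2t+1)(−1)^t/(t+½)³ = 8 Σ (−1)^t/(2t+1)²`.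
[cite: KrattenthalerZudilin2019, §2] -/
theorem catalanR_zero : catalanR 0 = 8 * catalanConstant := by
  rw [catalanR, Literature.NumberTheory.Transcendental.catalanConstant, ← tsum_mul_left]
  refine tsum_congr fun t => ?_
  simp only [Nat.factorial_zero, Nat.cast_one, mul_one, prod_range_zero, Nat.cast_zero, add_zero,
    zero_add, prod_range_one]
  have ht : (2 * (t : ℝ) + 1) ≠ 0 := by positivity
  have ht' : ((t : ℝ) + 1 / 2) ≠ 0 := by positivity
  rw [show ((t : ℝ) + 1 / 2) = (2 * t + 1) / 2 by ring]
  field_simp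
  ring

/-! ## §4 — `π²`, `π⁴`: the well-poised `₅F₄` sum and eq. (8) -/

/-- The rational function of §4:
`R_n(t) = 2^{8n} n!⁴ (2n)!² ∏_{j=0}^{4n−1}(t−n+j) / ((4n)! ∏_{j=0}^{2n}(t−½+j)⁴)`, with the well-poised
symmetry `R_n(t) = R_n(2n−1−t)`. [cite: KrattenthalerZudilin2019, §4 (definition of R_n)] -/
def RFour (n : ℕ) (t : ℝ) : ℝ :=
  2 ^ (8 * n) * (n ! : ℝ) ^ 4 * ((2 * n)! : ℝ) ^ 2 * (∏ j ∈ range (4 * n), (t - n + j)) /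
    (((4 * n)! : ℝ) * ∏ j ∈ range (2 * n + 1), (t - 1 / 2 + j) ^ 4)

/-- `r_n = Σ_{t ≥ 1} R_n(t)` (§4, first display; written over `t = u + 1`, `u ≥ 0`).
[cite: KrattenthalerZudilin2019, §4 (definition of r_n)] -/
def rFour (n : ℕ) : ℝ := ∑' u : ℕ, RFour n ((u : ℝ) + 1)

/-- The general term of `₃F₂(2n+1, 2n+1, 2n+1; 4n+2, 4n+2; 1)`:
`((2n+1)_ν)³ / (((4n+2)_ν)² ν!)` with `(x)_ν = ∏_{j<ν}(x+j)`. [cite: KrattenthalerZudilin2019, §4 eq. (8)] -/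
def threeFTwoTerm (n ν : ℕ) : ℝ :=
  (∏ j ∈ range ν, ((2 * n + 1 : ℝ) + j)) ^ 3 / ((∏ j ∈ range ν, ((4 * n + 2 : ℝ) + j)) ^ 2 * (ν ! : ℝ))

/-- The right-hand side of §4: `π² (2n)!⁴/(4n+1)!² · ₃F₂(2n+1, 2n+1, 2n+1; 4n+2, 4n+2; 1)` — "a 'rarified'
sequence of the Apéry approximations to `ζ(2)`". [cite: KrattenthalerZudilin2019, §4 (display before eq. (8))] -/
def rFourHyp (n : ℕ) : ℝ :=
  Real.pi ^ 2 * ((2 * n)! : ℝ) ^ 4 / ((4 * n + 1)! : ℝ) ^ 2 * ∑' ν : ℕ, threeFTwoTerm n ν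

/-- §4, eq. (8) (with the definition of `r_n`): "it turns out that
`r_n = π²(2n)!⁴/(4n+1)!² · ₃F₂(2n+1, 2n+1, 2n+1; 4n+2, 4n+2; 1)`", a consequence of the hypergeometric
identity (8) `Γ(4n+2)²Γ(2n+1)²/Γ(3n+3/2)⁴ · ₅F₄(4n+1, n+½, n+½, n+½, n+½; 3n+3/2, …; 1) = ₃F₂(…; 1)`, itself
the case `a = b = c = 2n+1` of Theorem 4. Named fact (statement only).
[cite: KrattenthalerZudilin2019, §4 eq. (8) and Theorem 4] -/
def rFour_eq_hypergeometric : Prop :=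
  ∀ n : ℕ, rFour n = rFourHyp n

/-- §4: "`r_n = a_n π⁴ − b_n π² ∈ ℚπ⁴ + ℚπ²` for all `n`" (a priori `r_n ∈ ℚπ⁴ + ℚπ² + ℚ`; the rational part
vanishes because `R_n` vanishes at `t = 1, 0, −1, …, −n+2`, by Lemma 1). Named fact (statement only).
[cite: KrattenthalerZudilin2019, §4 (paragraph before Lemma 1)] -/
def rFour_mem_span : Prop :=
  ∀ n : ℕ, ∃ a b : ℚ, rFour n = a * Real.pi ^ 4 - b * Real.pi ^ 2

/-- §4: `r_1 = 19π⁴/6 − 125π²/4` (printed initial value; numerically `0.0369840736…`). Named fact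
(statement only). [cite: KrattenthalerZudilin2019, §4 (display "r_0 = π⁴/6, r_1 = …")] -/
def rFour_one : Prop :=
  rFour 1 = 19 / 6 * Real.pi ^ 4 - 125 / 4 * Real.pi ^ 2

/-- `Σ_{u ≥ 0} (u + ½)^{−s}` is summable for `s ≥ 2`. [folklore] -/
private theorem summable_one_div_add_half_pow {s : ℕ} (hs : 2 ≤ s) :
    Summable fun u : ℕ => 1 / ((u : ℝ) + 1 / 2) ^ s := by
  have hsum : Summable fun n : ℕ => 1 / (n : ℝ) ^ s := Real.summable_one_div_nat_pow.mpr (by omega)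
  have hinj : Function.Injective fun k : ℕ => 2 * k + 1 := fun a b h => by simpa using h
  have ho : Summable fun k : ℕ => 1 / ((2 * k + 1 : ℕ) : ℝ) ^ s := hsum.comp_injective hinj
  refine (ho.mul_left ((2 : ℝ) ^ s)).congr fun k => ?_
  rw [Nat.cast_add, Nat.cast_mul, Nat.cast_two, Nat.cast_one,
    show (2 : ℝ) * k + 1 = 2 * ((k : ℝ) + 1 / 2) by ring, mul_pow]
  have h2 : (2 : ℝ) ^ s ≠ 0 := pow_ne_zero _ two_ne_zero
  have hk : ((k : ℝ) + 1 / 2) ^ s ≠ 0 := by positivity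
  field_simp

/-- `Σ_{u ≥ 0} (u + ½)^{−s} = (2^s − 1) ζ(s)` as a `HasSum` (`s ≥ 2`; the tree's `zetaHat_eq`).
[cite: KrattenthalerZudilin2019, Lemma 1 (second equality)] -/
theorem hasSum_one_div_add_half_pow {s : ℕ} (hs : 2 ≤ s) :
    HasSum (fun u : ℕ => 1 / ((u : ℝ) + 1 / 2) ^ s) ((2 ^ s - 1) * zetaValue s) := by
  rw [← zetaHat_eq hs]
  exact (summable_one_div_add_half_pow hs).hasSum

/-- `r_0 = π⁴/6`: at `n = 0`, `R_0(t) = (t − ½)^{−4}` and `Σ_{t ≥ 1}(t−½)^{−4} = 15 ζ(4) = π⁴/6`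
(the printed initial value). [cite: KrattenthalerZudilin2019, §4 (display "r_0 = π⁴/6")] -/
theorem rFour_zero : rFour 0 = Real.pi ^ 4 / 6 := by
  have h4 : zetaValue 4 = Real.pi ^ 4 / 90 := by
    rw [zetaValue, hasSum_zeta_four.tsum_eq]
  have hS := (hasSum_one_div_add_half_pow (s := 4) (by norm_num)).tsum_eq
  rw [h4] at hS
  have : rFour 0 = ∑' u : ℕ, 1 / ((u : ℝ) + 1 / 2) ^ 4 := by
    rw [rFour]
    refine tsum_congr fun u => ?_
    simp only [RFour, mul_zero, pow_zero, Nat.factorial_zero, Nat.cast_one, one_pow, mul_one,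
      prod_range_zero, Nat.cast_zero, sub_zero, zero_add, prod_range_one, one_mul]
    ring
  rw [this, hS]
  ring


/-! ## §4 — Lemma 1: the half-integer cancellation lemma (PROVED)

For a rational function `R(t) = Σ_{i=1}^{s} Σ_{k=0}^{n} a_{i,k}/(t+k)^i` with the well-poised symmetry
`R(t) = R(−n−t)`, the coefficients satisfy `a_{i,n−k} = (−1)^i a_{i,k}` and the sum of the values of `R`
over the half-integers `≥ −m − ½`, `m = ⌊(n−1)/2⌋`, is `Σ_{i even} a_i (2^i−1)ζ(i) + a_0` with
`a_i = Σ_k a_{i,k}`, `a_0 = 0` (`n` even), `a_0 = ½R(−m−½)` (`n` odd): the odd zeta values drop out.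
We prove this with the series understood, as printed, as the limit of its partial sums
(`Σ_{t=−m}^{∞} = lim_T Σ_{t=−m}^{T}`); the first sample point `−m − ½` is `−n/2` for odd `n` and
`−n/2 + ½` for even `n` (`firstPoint`). Proof (ours, replacing the paper's rearrangement of one-sided sums
by a symmetric window): by the symmetry, twice the partial sum (minus the centre term `R(−n/2)` when `n` is
odd) is a sum of `R` over a window of consecutive half-integers symmetric about `−n/2`; on such a window
`Σ (u+½)^{−i}` over `−M ≤ u < N` equals `(−1)^i H_i(M) + H_i(N)` with `H_i(N) = Σ_{ℓ<N}(ℓ+½)^{−i}`, which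
tends to `(1 + (−1)^i)(2^i−1)ζ(i)` for `i ≥ 2` and to `0` for `i = 1` as `M, N → ∞` with `N − M` fixed.
-/

namespace Lemma1

variable {a : ℕ → ℕ → ℝ} {s n : ℕ}

/-- `R(t) = Σ_{i=1}^{s} Σ_{k=0}^{n} a_{i,k}/(t+k)^i` (a partial-fraction sum with poles at `0, −1, …, −n` of
order `≤ s`). [cite: KrattenthalerZudilin2019, Lemma 1] -/
def R (a : ℕ → ℕ → ℝ) (s n : ℕ) (t : ℝ) : ℝ :=
  ∑ i ∈ Icc 1 s, ∑ k ∈ range (n + 1), a i k / (t + k) ^ i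

/-- The coefficient symmetry `a_{i,n−k} = (−1)^i a_{i,k}` (`1 ≤ i ≤ s`, `0 ≤ k ≤ n`).
[cite: KrattenthalerZudilin2019, Lemma 1] -/
def CoeffSymm (a : ℕ → ℕ → ℝ) (s n : ℕ) : Prop :=
  ∀ i ∈ Icc 1 s, ∀ k ≤ n, a i (n - k) = (-1) ^ i * a i k

/-- `a_i = Σ_{k=0}^{n} a_{i,k}`. [cite: KrattenthalerZudilin2019, Lemma 1] -/
def aSum (a : ℕ → ℕ → ℝ) (n i : ℕ) : ℝ := ∑ k ∈ range (n + 1), a i k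

/-- `(2^i − 1) ζ(i) = Σ_{ℓ ≥ 1} (ℓ − ½)^{−i}` (`i ≥ 2`). [cite: KrattenthalerZudilin2019, Lemma 1] -/
def Z (i : ℕ) : ℝ := (2 ^ i - 1) * zetaValue i

/-- `H_i(N) = Σ_{ℓ<N} (ℓ + ½)^{−i}`, the partial sums of `Σ_{ℓ ≥ 1}(ℓ − ½)^{−i}`. [folklore] -/
def Hp (i N : ℕ) : ℝ := ∑ l ∈ range N, 1 / ((l : ℝ) + 1 / 2) ^ i

/-- The first sample point `−m − ½`, `m = ⌊(n−1)/2⌋`: `−n/2` for odd `n`, `−n/2 + ½` for even `n`.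
[cite: KrattenthalerZudilin2019, Lemma 1] -/
def firstPoint (n : ℕ) : ℝ := if Even n then -(n : ℝ) / 2 + 1 / 2 else -(n : ℝ) / 2

/-- The constant term `a_0`: `0` for even `n`, `½ R(−m−½) = ½ R(−n/2)` for odd `n`.
[cite: KrattenthalerZudilin2019, Lemma 1] -/
def aZero (a : ℕ → ℕ → ℝ) (s n : ℕ) : ℝ := if Even n then 0 else R a s n (-(n : ℝ) / 2) / 2

/-- `1/(−y)^i = (−1)^i/y^i`. [folklore] -/
private theorem one_div_neg_pow (y : ℝ) (i : ℕ) : 1 / (-y) ^ i = (-1) ^ i * (1 / y ^ i) := by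
  rw [neg_pow]
  rcases neg_one_pow_eq_or ℝ i with h | h <;> rw [h]
  · ring
  · rw [neg_one_mul, one_div_neg_eq_neg_one_div, neg_one_mul]

/-- The coefficient symmetry implies the functional symmetry `R(−n−x) = R(x)` (reindex `k ↦ n − k`).
[cite: KrattenthalerZudilin2019, Lemma 1] -/
theorem R_reflect (h : CoeffSymm a s n) (x : ℝ) : R a s n (-(n : ℝ) - x) = R a s n x := by
  unfold R
  refine sum_congr rfl fun i hi => ?_
  rw [← sum_range_reflect (fun k => a i k / (x + k) ^ i) (n + 1)]
  refine sum_congr rfl fun k hk => ?_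
  have hkn : k ≤ n := Nat.lt_succ_iff.mp (mem_range.mp hk)
  simp only [add_tsub_cancel_right]
  rw [Nat.cast_sub hkn, h i hi k hkn]
  have e : (-(n : ℝ) - x + k) = -(x + (n - k)) := by ring
  rw [e, div_eq_mul_one_div (a i k), one_div_neg_pow]
  ring

/-- The window identity: `Σ_{u<M+N} ((u − M) + ½)^{−i} = (−1)^i H_i(M) + H_i(N)`. [folklore] -/
private theorem sum_window (i M N : ℕ) :
    ∑ u ∈ range (M + N), 1 / (((u : ℝ) - M) + 1 / 2) ^ i = (-1) ^ i * Hp i M + Hp i N := by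
  rw [sum_range_add]
  congr 1
  · rw [Hp, mul_sum, ← sum_range_reflect _ M]
    refine sum_congr rfl fun u hu => ?_
    have huM : u < M := mem_range.mp hu
    have h1 : u ≤ M - 1 := by omega
    have h2 : 1 ≤ M := by omega
    rw [Nat.cast_sub h1, Nat.cast_sub h2, Nat.cast_one]
    have e : ((M : ℝ) - 1 - u - M + 1 / 2) = -((u : ℝ) + 1 / 2) := by ring
    rw [e, one_div_neg_pow]
  · refine sum_congr rfl fun u _ => ?_
    rw [Nat.cast_add, show ((M : ℝ) + u - M + 1 / 2) = u + 1 / 2 by ring]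

/-- `H_i(N) → (2^i − 1)ζ(i)` (`i ≥ 2`). [cite: KrattenthalerZudilin2019, Lemma 1] -/
theorem tendsto_Hp {i : ℕ} (hi : 2 ≤ i) : Tendsto (Hp i) atTop (𝓝 (Z i)) :=
  (hasSum_one_div_add_half_pow hi).tendsto_sum_nat

/-- `H_1(N + c) − H_1(N) → 0` for fixed `c`. [folklore] -/
private theorem tendsto_Hp_one_shift (c : ℕ) :
    Tendsto (fun N : ℕ => Hp 1 (N + c) - Hp 1 N) atTop (𝓝 0) := by
  have e : ∀ N : ℕ, Hp 1 (N + c) - Hp 1 N = ∑ u ∈ range c, 1 / (((N : ℝ) + u) + 1 / 2) := by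
    intro N
    rw [Hp, Hp, sum_range_add, add_sub_cancel_left]
    refine sum_congr rfl fun u _ => ?_
    rw [pow_one, Nat.cast_add]
  simp_rw [e]
  have h0 : ∀ u ∈ range c, Tendsto (fun N : ℕ => 1 / (((N : ℝ) + u) + 1 / 2)) atTop (𝓝 0) := by
    intro u _
    refine tendsto_const_nhds.div_atTop ?_
    exact (tendsto_natCast_atTop_atTop.atTop_add tendsto_const_nhds).atTop_add tendsto_const_nhds
  simpa using tendsto_finsetSum (range c) h0

/-- The limit of a symmetric window: `(−1)^i H_i(T + c) + H_i(T + d) → (1 + (−1)^i)(2^i−1)ζ(i)`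
(`i ≥ 1`; for `i = 1` the limit is `0`). [folklore] -/
private theorem tendsto_window {i : ℕ} (hi : 1 ≤ i) (c d : ℕ) :
    Tendsto (fun T : ℕ => (-1 : ℝ) ^ i * Hp i (T + c) + Hp i (T + d)) atTop
      (𝓝 ((1 + (-1) ^ i) * Z i)) := by
  rcases Nat.lt_or_ge i 2 with h | h
  · obtain rfl : i = 1 := by omega
    have e : ∀ T : ℕ, (-1 : ℝ) ^ 1 * Hp 1 (T + c) + Hp 1 (T + d) =
        (Hp 1 (T + d) - Hp 1 T) - (Hp 1 (T + c) - Hp 1 T) := by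
      intro T
      ring
    simp_rw [e]
    have := (tendsto_Hp_one_shift d).sub (tendsto_Hp_one_shift c)
    simpa using this
  · have h1 : Tendsto (fun T : ℕ => (-1 : ℝ) ^ i * Hp i (T + c)) atTop (𝓝 ((-1) ^ i * Z i)) :=
      ((tendsto_Hp h).comp (tendsto_add_atTop_nat c)).const_mul _
    have h2 : Tendsto (fun T : ℕ => Hp i (T + d)) atTop (𝓝 (Z i)) :=
      (tendsto_Hp h).comp (tendsto_add_atTop_nat d)
    have := h1.add h2
    rwa [show (-1 : ℝ) ^ i * Z i + Z i = (1 + (-1) ^ i) * Z i by ring] at this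

/-- A window of `R`: `Σ_{u<M+N} R((u − M) + ½) = Σ_i Σ_k a_{i,k} ((−1)^i H_i(M_k) + H_i(N_k))` — bookkeeping
lemma: the sum of `R` over consecutive half-integers starting at `x`, written per coefficient, when
`x + k = −(M_k) + ½` and the number of terms is `M_k + N_k` for every `k`. [folklore] -/
private theorem sum_R_window (x : ℝ) (L : ℕ) (M N : ℕ → ℕ) (hMN : ∀ k ≤ n, M k + N k = L)
    (hx : ∀ k ≤ n, x + k = -(M k : ℝ) + 1 / 2) :
    ∑ u ∈ range L, R a s n (x + u) =
      ∑ i ∈ Icc 1 s, ∑ k ∈ range (n + 1), a i k * ((-1) ^ i * Hp i (M k) + Hp i (N k)) := by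
  unfold R
  rw [sum_comm]
  refine sum_congr rfl fun i _ => ?_
  rw [sum_comm]
  refine sum_congr rfl fun k hk => ?_
  have hkn : k ≤ n := Nat.lt_succ_iff.mp (mem_range.mp hk)
  rw [← sum_window, ← hMN k hkn, mul_sum]
  refine sum_congr rfl fun u _ => ?_
  rw [div_eq_mul_one_div, show x + (u : ℝ) + k = (u : ℝ) - (M k) + 1 / 2 by rw [← sub_eq_zero]; have := hx k hkn; linarith]

/-- `Σ_i Σ_k a_{i,k} (1 + (−1)^i) Z_i = 2 Σ_{i even} a_i Z_i`. [folklore] -/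
private theorem sum_limit_eq :
    ∑ i ∈ Icc 1 s, ∑ k ∈ range (n + 1), a i k * ((1 + (-1) ^ i) * Z i) =
      2 * ∑ i ∈ (Icc 1 s).filter Even, aSum a n i * Z i := by
  rw [sum_filter, mul_sum]
  refine sum_congr rfl fun i _ => ?_
  rw [← sum_mul, ← aSum]
  split_ifs with hi
  · rw [hi.neg_one_pow]
    ring
  · rw [(Nat.not_even_iff_odd.mp hi).neg_one_pow]
    ring

/-- The limit of the windows: `Σ_i Σ_k a_{i,k}((−1)^i H_i(T + c_k) + H_i(T + d_k)) → 2 Σ_{i even} a_i Z_i`.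
[folklore] -/
private theorem tendsto_sum_windows (c d : ℕ → ℕ) :
    Tendsto (fun T : ℕ => ∑ i ∈ Icc 1 s, ∑ k ∈ range (n + 1),
        a i k * ((-1) ^ i * Hp i (T + c k) + Hp i (T + d k))) atTop
      (𝓝 (2 * ∑ i ∈ (Icc 1 s).filter Even, aSum a n i * Z i)) := by
  rw [← sum_limit_eq]
  refine tendsto_finsetSum _ fun i hi => tendsto_finsetSum _ fun k _ => ?_
  exact (tendsto_window (mem_Icc.mp hi).1 (c k) (d k)).const_mul _

/-- **Lemma 1, odd `n`**: for `n = 2q+1` and coefficients with `a_{i,n−k} = (−1)^i a_{i,k}`,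
`Σ_{t=0}^{T−1} R(−n/2 + t) → Σ_{i even} a_i (2^i−1)ζ(i) + ½R(−n/2)` (`T → ∞`).
[cite: KrattenthalerZudilin2019, Lemma 1 (case n odd)] -/
theorem tendsto_partialSum_odd (h : CoeffSymm a s n) (hn : Odd n) :
    Tendsto (fun T : ℕ => ∑ t ∈ range T, R a s n (-(n : ℝ) / 2 + t)) atTop
      (𝓝 (∑ i ∈ (Icc 1 s).filter Even, aSum a n i * Z i + R a s n (-(n : ℝ) / 2) / 2)) := by
  obtain ⟨q, hq⟩ := hn
  set c : ℝ := -(n : ℝ) / 2 with hc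
  have hcq : c = -(q : ℝ) - 1 / 2 := by rw [hc, hq]; push_cast; ring
  -- the windows `V T = Σ_{u < 2T+2q+3} R(c − (T+q+1) + u)`
  have hV : ∀ T : ℕ, ∑ u ∈ range (2 * T + 2 * q + 3), R a s n ((c - (T + q + 1 : ℕ)) + u) =
      ∑ i ∈ Icc 1 s, ∑ k ∈ range (n + 1),
        a i k * ((-1) ^ i * Hp i (T + (n + 1 - k)) + Hp i (T + (k + 1))) := by
    intro T
    refine sum_R_window _ _ (fun k => T + (n + 1 - k)) (fun k => T + (k + 1)) ?_ ?_
    · intro k hk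
      omega
    · intro k hk
      rw [Nat.cast_add T (n + 1 - k), Nat.cast_sub (by omega : k ≤ n + 1), hcq, hq]
      push_cast
      ring
  -- `V T = 2 S(T+q+2) − R(c)`
  have hVS : ∀ T : ℕ, ∑ u ∈ range (2 * T + 2 * q + 3), R a s n ((c - (T + q + 1 : ℕ)) + u) =
      2 * ∑ t ∈ range (T + q + 2), R a s n (c + t) - R a s n c := by
    intro T
    rw [show 2 * T + 2 * q + 3 = (T + q + 1) + (T + q + 2) by ring, sum_range_add]
    have h1 : ∑ u ∈ range (T + q + 1), R a s n ((c - (T + q + 1 : ℕ)) + u) =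
        ∑ u ∈ range (T + q + 1), R a s n (c + (u + 1 : ℕ)) := by
      rw [← sum_range_reflect _ (T + q + 1)]
      refine sum_congr rfl fun u hu => ?_
      have huT : u < T + q + 1 := mem_range.mp hu
      rw [← R_reflect h (c + (u + 1 : ℕ))]
      congr 1
      rw [Nat.cast_sub (by omega : u ≤ T + q + 1 - 1), Nat.cast_sub (by omega : 1 ≤ T + q + 1), hcq, hq]
      push_cast
      ring
    have h2 : ∑ u ∈ range (T + q + 2), R a s n ((c - (T + q + 1 : ℕ)) + ((T + q + 1 + u : ℕ) : ℝ)) =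
        ∑ u ∈ range (T + q + 2), R a s n (c + u) := by
      refine sum_congr rfl fun u _ => ?_
      congr 1
      push_cast
      ring
    rw [h1, h2, sum_range_succ' (fun t => R a s n (c + t)) (T + q + 1)]
    simp only [Nat.cast_zero, add_zero, Nat.cast_add, Nat.cast_one]
    ring
  -- the limit of the windows
  have hlim := tendsto_sum_windows (a := a) (s := s) (n := n) (fun k => n + 1 - k) (fun k => k + 1)
  have hlim' : Tendsto (fun T : ℕ => 2 * ∑ t ∈ range (T + q + 2), R a s n (c + t) - R a s n c) atTop
      (𝓝 (2 * ∑ i ∈ (Icc 1 s).filter Even, aSum a n i * Z i)) := by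
    refine hlim.congr fun T => ?_
    rw [← hV T, hVS T]
  -- unwind: `S(T+q+2) = (V T + R c)/2`
  have hS : Tendsto (fun T : ℕ => ∑ t ∈ range (T + (q + 2)), R a s n (c + t)) atTop
      (𝓝 (∑ i ∈ (Icc 1 s).filter Even, aSum a n i * Z i + R a s n c / 2)) := by
    have := (hlim'.add_const (R a s n c)).div_const 2
    refine (this.congr fun T => ?_).trans ?_
    · rw [show T + (q + 2) = T + q + 2 by ring]
      ring
    · rw [show (2 * ∑ i ∈ (Icc 1 s).filter Even, aSum a n i * Z i + R a s n c) / 2 =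
          ∑ i ∈ (Icc 1 s).filter Even, aSum a n i * Z i + R a s n c / 2 by ring]
  exact (tendsto_add_atTop_iff_nat (q + 2)).mp hS

/-- **Lemma 1, even `n`**: for `n = 2q` and coefficients with `a_{i,n−k} = (−1)^i a_{i,k}`,
`Σ_{t=0}^{T−1} R(−n/2 + ½ + t) → Σ_{i even} a_i (2^i−1)ζ(i)` (`T → ∞`).
[cite: KrattenthalerZudilin2019, Lemma 1 (case n even)] -/
theorem tendsto_partialSum_even (h : CoeffSymm a s n) (hn : Even n) :
    Tendsto (fun T : ℕ => ∑ t ∈ range T, R a s n (-(n : ℝ) / 2 + 1 / 2 + t)) atTop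
      (𝓝 (∑ i ∈ (Icc 1 s).filter Even, aSum a n i * Z i)) := by
  obtain ⟨q, hq⟩ := hn
  set x : ℝ := -(n : ℝ) / 2 + 1 / 2 with hx
  have hxq : x = -(q : ℝ) + 1 / 2 := by rw [hx, hq]; push_cast; ring
  -- the windows `W T = Σ_{u < 2T+2q} R(x − (T+q) + u)`
  have hW : ∀ T : ℕ, ∑ u ∈ range (2 * T + 2 * q), R a s n ((x - (T + q : ℕ)) + u) =
      ∑ i ∈ Icc 1 s, ∑ k ∈ range (n + 1),
        a i k * ((-1) ^ i * Hp i (T + (n - k)) + Hp i (T + k)) := by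
    intro T
    refine sum_R_window _ _ (fun k => T + (n - k)) (fun k => T + k) ?_ ?_
    · intro k hk
      omega
    · intro k hk
      rw [Nat.cast_add T (n - k), Nat.cast_sub hk, hxq, hq]
      push_cast
      ring
  -- `W T = 2 S(T+q)`
  have hWS : ∀ T : ℕ, ∑ u ∈ range (2 * T + 2 * q), R a s n ((x - (T + q : ℕ)) + u) =
      2 * ∑ t ∈ range (T + q), R a s n (x + t) := by
    intro T
    rw [show 2 * T + 2 * q = (T + q) + (T + q) by ring, sum_range_add]
    have h1 : ∑ u ∈ range (T + q), R a s n ((x - (T + q : ℕ)) + u) =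
        ∑ u ∈ range (T + q), R a s n (x + u) := by
      rw [← sum_range_reflect _ (T + q)]
      refine sum_congr rfl fun u hu => ?_
      have huT : u < T + q := mem_range.mp hu
      rw [← R_reflect h (x + u)]
      congr 1
      rw [Nat.cast_sub (by omega : u ≤ T + q - 1), Nat.cast_sub (by omega : 1 ≤ T + q), hxq, hq]
      push_cast
      ring
    have h2 : ∑ u ∈ range (T + q), R a s n ((x - (T + q : ℕ)) + ((T + q + u : ℕ) : ℝ)) =
        ∑ u ∈ range (T + q), R a s n (x + u) := by
      refine sum_congr rfl fun u _ => ?_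
      congr 1
      push_cast
      ring
    rw [h1, h2]
    ring
  have hlim := tendsto_sum_windows (a := a) (s := s) (n := n) (fun k => n - k) (fun k => k)
  have hlim' : Tendsto (fun T : ℕ => 2 * ∑ t ∈ range (T + q), R a s n (x + t)) atTop
      (𝓝 (2 * ∑ i ∈ (Icc 1 s).filter Even, aSum a n i * Z i)) := by
    refine hlim.congr fun T => ?_
    rw [← hW T, hWS T]
  have hS : Tendsto (fun T : ℕ => ∑ t ∈ range (T + q), R a s n (x + t)) atTop
      (𝓝 (∑ i ∈ (Icc 1 s).filter Even, aSum a n i * Z i)) := by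
    have := hlim'.div_const 2
    refine (this.congr fun T => ?_).trans ?_
    · ring
    · rw [show (2 * ∑ i ∈ (Icc 1 s).filter Even, aSum a n i * Z i) / 2 =
          ∑ i ∈ (Icc 1 s).filter Even, aSum a n i * Z i by ring]
  exact (tendsto_add_atTop_iff_nat q).mp hS

/-- Uniqueness of partial-fraction coefficients: if `Σ_{i=1}^{s} Σ_{k=0}^{n} c_{i,k}(x+k)^{−i} = 0` for every
real `x` off the poles `0, −1, …, −n`, then every `c_{i,k}` (`1 ≤ i ≤ s`, `k ≤ n`) vanishes (induction on the
pole order: `ε^{i₀} R(−k₀ + ε) → c_{i₀,k₀}` as `ε → 0` once the higher-order coefficients at `−k₀` vanish).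
This is the uniqueness of the partial-fraction expansion behind the first assertion of Lemma 1 ("The property
`a_{i,n−k} = (−1)^i a_{i,k}` is straightforward to see from `R(t) = R(−n−t)`").
[cite: KrattenthalerZudilin2019, Lemma 1 (proof of the first assertion)] -/
theorem coeff_eq_zero_of_R_eq_zero {c : ℕ → ℕ → ℝ}
    (h : ∀ x : ℝ, (∀ k ≤ n, x + (k : ℝ) ≠ 0) → R c s n x = 0) :
    ∀ i ∈ Icc 1 s, ∀ k ≤ n, c i k = 0 := by
  suffices key : ∀ k₀ ≤ n, ∀ m : ℕ, ∀ i ∈ Icc 1 s, s - i = m → c i k₀ = 0 by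
    intro i hi k hk
    exact key k hk (s - i) i hi rfl
  intro k₀ hk₀ m
  induction m using Nat.strong_induction_on with
  | _ m IH =>
  intro i₀ hi₀ hm
  have hi₀' := mem_Icc.mp hi₀
  have hzero : ∀ i ∈ Icc 1 s, i₀ < i → c i k₀ = 0 := fun i hi hlt =>
    IH (s - i) (by have := (mem_Icc.mp hi).2; omega) i hi rfl
  -- `g(ε) = ε^{i₀} R(−k₀ + ε)`, written per coefficient
  set g : ℝ → ℝ := fun ε => ∑ i ∈ Icc 1 s, ∑ k ∈ range (n + 1),
    c i k * (ε ^ i₀ / (ε + ((k : ℝ) - k₀)) ^ i) with hg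
  have hgR : ∀ ε : ℝ, g ε = ε ^ i₀ * R c s n (-(k₀ : ℝ) + ε) := by
    intro ε
    rw [hg, R, mul_sum]
    refine sum_congr rfl fun i _ => ?_
    rw [mul_sum]
    refine sum_congr rfl fun k _ => ?_
    rw [show (-(k₀ : ℝ) + ε + k) = ε + (k - k₀) by ring]
    ring
  -- (b) `g = 0` on a punctured neighbourhood of `0`
  have hg0 : ∀ᶠ ε in 𝓝[≠] (0 : ℝ), g ε = 0 := by
    have h1 : ∀ᶠ ε in 𝓝[≠] (0 : ℝ), ε ∈ ({0}ᶜ : Set ℝ) := eventually_mem_nhdsWithin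
    have h2 : ∀ᶠ ε in 𝓝[≠] (0 : ℝ), ε < 1 :=
      (eventually_lt_nhds zero_lt_one).filter_mono nhdsWithin_le_nhds
    have h3 : ∀ᶠ ε in 𝓝[≠] (0 : ℝ), -1 < ε :=
      (eventually_gt_nhds (by norm_num : (-1 : ℝ) < 0)).filter_mono nhdsWithin_le_nhds
    filter_upwards [h1, h2, h3] with ε h1 h2 h3
    have hε : ε ≠ 0 := h1
    rw [hgR, h _ ?_, mul_zero]
    intro k _ habs
    have hεk : ε = (k₀ : ℝ) - k := by linarith
    rcases lt_trichotomy k₀ k with hlt | heq | hgt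
    · have : (k₀ : ℝ) + 1 ≤ k := by exact_mod_cast hlt
      linarith
    · subst heq
      rw [sub_self] at hεk
      exact hε hεk
    · have : (k : ℝ) + 1 ≤ k₀ := by exact_mod_cast hgt
      linarith
  -- (a) `g → c_{i₀,k₀}`
  set L : ℕ → ℕ → ℝ := fun i k => if k = k₀ ∧ i = i₀ then c i₀ k₀ else 0 with hL
  have hsum : ∑ i ∈ Icc 1 s, ∑ k ∈ range (n + 1), L i k = c i₀ k₀ := by
    rw [sum_eq_single_of_mem i₀ hi₀]
    · rw [sum_eq_single_of_mem k₀ (mem_range.mpr (by omega))]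
      · simp [hL]
      · intro k _ hk
        simp [hL, hk]
    · intro i _ hi
      refine sum_eq_zero fun k _ => ?_
      simp [hL, hi]
  have hga : Tendsto g (𝓝[≠] 0) (𝓝 (c i₀ k₀)) := by
    rw [← hsum, hg]
    refine tendsto_finsetSum _ fun i hi => tendsto_finsetSum _ fun k _ => ?_
    by_cases hkk : k = k₀
    · subst hkk
      rcases lt_trichotomy i i₀ with hlt | heq | hgt
      · have hLik : L i k = c i k * 0 := by simp [hL, hlt.ne]
        rw [hLik]
        refine Tendsto.const_mul _ ?_
        have hev : (fun ε : ℝ => ε ^ i₀ / (ε + ((k : ℝ) - k)) ^ i) =ᶠ[𝓝[≠] 0]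
            fun ε => ε ^ (i₀ - i) := by
          filter_upwards [eventually_mem_nhdsWithin] with ε hε
          rw [sub_self, add_zero, div_eq_mul_inv, ← pow_sub₀ ε hε hlt.le]
        rw [tendsto_congr' hev]
        have := (continuous_pow (i₀ - i)).tendsto (0 : ℝ)
        rw [zero_pow (by omega)] at this
        exact tendsto_nhdsWithin_of_tendsto_nhds this
      · subst heq
        have hLik : L i k = c i k * 1 := by simp [hL]
        rw [hLik]
        refine Tendsto.const_mul _ ?_
        have hev : (fun ε : ℝ => ε ^ i / (ε + ((k : ℝ) - k)) ^ i) =ᶠ[𝓝[≠] 0] fun _ => (1 : ℝ) := by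
          filter_upwards [eventually_mem_nhdsWithin] with ε hε
          rw [sub_self, add_zero, div_self (pow_ne_zero _ hε)]
        rw [tendsto_congr' hev]
        exact tendsto_const_nhds
      · have hc0 : c i k = 0 := hzero i hi hgt
        have hLik : L i k = 0 := by simp [hL, hgt.ne']
        rw [hLik, hc0]
        simp only [zero_mul]
        exact tendsto_const_nhds
    · have hd : ((k : ℝ) - k₀) ≠ 0 := sub_ne_zero.mpr (by exact_mod_cast hkk)
      have hLik : L i k = c i k * (0 ^ i₀ / ((0 : ℝ) + (k - k₀)) ^ i) := by
        simp [hL, hkk, zero_pow (by omega : i₀ ≠ 0)]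
      rw [hLik]
      refine Tendsto.const_mul _ (tendsto_nhdsWithin_of_tendsto_nhds ?_)
      have hnum : Tendsto (fun ε : ℝ => ε ^ i₀) (𝓝 0) (𝓝 (0 ^ i₀)) := (continuous_pow i₀).tendsto 0
      have hden : Tendsto (fun ε : ℝ => (ε + ((k : ℝ) - k₀)) ^ i) (𝓝 0) (𝓝 ((0 + ((k : ℝ) - k₀)) ^ i)) :=
        (tendsto_id.add tendsto_const_nhds).pow i
      exact hnum.div hden (by rw [zero_add]; exact pow_ne_zero _ hd)
  have hgb : Tendsto g (𝓝[≠] 0) (𝓝 0) :=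
    (tendsto_const_nhds (x := (0 : ℝ))).congr' (hg0.mono fun ε hε => hε.symm)
  exact tendsto_nhds_unique hga hgb

/-- The functional symmetry `R(t) = R(−n−t)` (off the poles) forces `a_{i,n−k} = (−1)^i a_{i,k}` — the first
assertion of Lemma 1 ("straightforward to see from `R(t) = R(−n−t)`"), by uniqueness of partial fractions.
[cite: KrattenthalerZudilin2019, Lemma 1 (first assertion)] -/
theorem coeffSymm_of_reflect
    (h : ∀ x : ℝ, (∀ k ≤ n, x + (k : ℝ) ≠ 0) → R a s n (-(n : ℝ) - x) = R a s n x) :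
    CoeffSymm a s n := by
  set c : ℕ → ℕ → ℝ := fun i k => a i k - (-1) ^ i * a i (n - k) with hc
  have hR : ∀ x : ℝ, (∀ k ≤ n, x + (k : ℝ) ≠ 0) → R c s n x = 0 := by
    intro x hx
    have e : R c s n x = R a s n x - R a s n (-(n : ℝ) - x) := by
      rw [R, R, R, ← sum_sub_distrib]
      refine sum_congr rfl fun i _ => ?_
      rw [← sum_range_reflect (fun k => a i k / (-(n : ℝ) - x + k) ^ i) (n + 1), ← sum_sub_distrib]
      refine sum_congr rfl fun k hk => ?_
      have hkn : k ≤ n := Nat.lt_succ_iff.mp (mem_range.mp hk)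
      simp only [add_tsub_cancel_right, hc]
      rw [Nat.cast_sub hkn]
      have e2 : (-(n : ℝ) - x + (n - k)) = -(x + k) := by ring
      rw [e2, div_eq_mul_one_div (a i (n - k)), one_div_neg_pow]
      ring
    rw [e, h x hx, sub_self]
  intro i hi k hk
  have h0 := coeff_eq_zero_of_R_eq_zero hR i hi (n - k) (by omega)
  simp only [hc, Nat.sub_sub_self hk] at h0
  linarith

/-- `a_{i,n−k} = (−1)^i a_{i,k}` for all `i, k` **iff** `R(−n−x) = R(x)` off the poles.
[cite: KrattenthalerZudilin2019, Lemma 1 (first assertion)] -/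
theorem coeffSymm_iff_reflect :
    CoeffSymm a s n ↔ ∀ x : ℝ, (∀ k ≤ n, x + (k : ℝ) ≠ 0) → R a s n (-(n : ℝ) - x) = R a s n x :=
  ⟨fun h x _ => R_reflect h x, coeffSymm_of_reflect⟩

/-- **Lemma 1** (Krattenthaler–Zudilin 2019; the half-integer cancellation lemma), in the printed form: if
the coefficients of `R(t) = Σ_{i=1}^{s} Σ_{k=0}^{n} a_{i,k}(t+k)^{−i}` satisfy `a_{i,n−k} = (−1)^i a_{i,k}`
(equivalently `R(t) = R(−n−t)`, see `coeffSymm_iff_reflect`), then with `m = ⌊(n−1)/2⌋`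
`Σ_{t=−m}^{∞} R(t − ½) = Σ_{i even} a_i (2^i − 1) ζ(i) + a_0`, `a_i = Σ_k a_{i,k}`, `a_0 = 0` (`n` even),
`a_0 = ½ R(−m − ½)` (`n` odd) — the series taken as the limit of its partial sums, the sample points being
`firstPoint n + t`, `t = 0, 1, 2, …` (`firstPoint n = −m − ½`). In particular no odd zeta value occurs.
[cite: KrattenthalerZudilin2019, Lemma 1] -/
theorem lemma1 (h : CoeffSymm a s n) :
    Tendsto (fun T : ℕ => ∑ t ∈ range T, R a s n (firstPoint n + t)) atTop
      (𝓝 (∑ i ∈ (Icc 1 s).filter Even, aSum a n i * ((2 ^ i - 1) * zetaValue i) + aZero a s n)) := by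
  unfold firstPoint aZero
  rcases Nat.even_or_odd n with hn | hn
  · simp only [if_pos hn, add_zero]
    exact tendsto_partialSum_even h hn
  · simp only [if_neg (Nat.not_even_iff_odd.mpr hn)]
    exact tendsto_partialSum_odd h hn

end Lemma1

/-! ## §1 — the comparison with [HP06] (restated in the source; secondary-cited) -/

/-- The coefficient `2^{2m}|B_{2m}|/(m(2m)!)` of the first [HP06] collection as displayed in §1.
[cite: KrattenthalerZudilin2019, §1 (display after Theorem 1)] -/
def hpCoeffOne (m : ℕ) : ℝ :=
  2 ^ (2 * m) * |((bernoulli (2 * m) : ℚ) : ℝ)| / (m * (2 * m)!)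

/-- The coefficient `2^{2m}|B_{2m+2}|/((m+1)(2m)!)` of the second [HP06] collection as displayed in §1.
[cite: KrattenthalerZudilin2019, §1 (display after Theorem 1)] -/
def hpCoeffTwo (m : ℕ) : ℝ :=
  2 ^ (2 * m) * |((bernoulli (2 * m + 2) : ℚ) : ℝ)| / ((m + 1) * (2 * m)!)

/-- The earlier result the source compares Theorem 1 with, AS RESTATED THERE: "The only result in the literature we
can compare our Theorem 1 with is the one given in [HP06, Theorems 3 and 4], which implies the irrationality of at
least one number in each collection `{ζ(2m+1) − λ·2^{2m}|B_{2m}|/(m(2m)!)·π^{2m+1} : m = 1, 2, …, 169}` and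
`{ζ(2m+1) − λ·2^{2m}|B_{2m+2}|/((m+1)(2m)!)·π^{2m+1} : m = 1, 2, …, 169}`, where `λ ∈ ℝ` is arbitrary." Here
[HP06] = T. & Kh. Hessami Pilehrood, *Irrationality of the sums of zeta values*, Math. Notes 79 (2006) 561–571 —
paywalled, not re-read (acq-12890): typed from the secondary restatement, both sources cited. Named fact
(statement only). [cite: KrattenthalerZudilin2019, §1 (display after Theorem 1)]
[cite: HessamiPilehrood2006, Theorems 3 and 4 (as restated in KrattenthalerZudilin2019 §1)] -/
def hessamiPilehrood2006_collections : Prop :=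
  ∀ l : ℝ,
    (∃ m : ℕ, 1 ≤ m ∧ m ≤ 169 ∧
        Irrational (zetaValue (2 * m + 1) - l * hpCoeffOne m * Real.pi ^ (2 * m + 1))) ∧
      ∃ m : ℕ, 1 ≤ m ∧ m ≤ 169 ∧
        Irrational (zetaValue (2 * m + 1) - l * hpCoeffTwo m * Real.pi ^ (2 * m + 1))

/-- The [HP06] shifts are the rational multiples `2ζ(2m)π/m`, resp. `(2m+1)ζ(2m+2)/π`, of `λ`:
`hpCoeffOne m · π^{2m+1} = (2/m)·ζ(2m)·π` (`m ≠ 0`). [cite: KrattenthalerZudilin2019, §1 (display after Theorem 1)] -/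
theorem hpCoeffOne_mul_pi_pow {m : ℕ} (hm : m ≠ 0) :
    hpCoeffOne m * Real.pi ^ (2 * m + 1) = 2 / m * zetaValue (2 * m) * Real.pi := by
  have hz := zetaValue_two_mul hm
  have hb := abs_bernoulli_two_mul hm
  rw [hpCoeffOne, hb, hz]
  have hpi : Real.pi ≠ 0 := Real.pi_ne_zero
  have hmR : (m : ℝ) ≠ 0 := by exact_mod_cast hm
  have hfac : ((2 * m)! : ℝ) ≠ 0 := by positivity
  have hpow : (2 : ℝ) ^ (2 * m) = 2 * 2 ^ (2 * m - 1) := by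
    rw [← pow_succ']
    congr 1
    omega
  rw [pow_succ, hpow]
  field_simp
  ring

/-- `hpCoeffTwo m · π^{2m+1} = (2m+1)·ζ(2m+2)/π`. [cite: KrattenthalerZudilin2019, §1 (display after Theorem 1)] -/
theorem hpCoeffTwo_mul_pi_pow (m : ℕ) :
    hpCoeffTwo m * Real.pi ^ (2 * m + 1) = (2 * m + 1) * zetaValue (2 * m + 2) / Real.pi := by
  have hk : m + 1 ≠ 0 := Nat.succ_ne_zero m
  have hz := zetaValue_two_mul hk
  have hb := abs_bernoulli_two_mul hk
  rw [show 2 * (m + 1) = 2 * m + 2 by ring] at hz hb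
  rw [show 2 * m + 2 - 1 = 2 * m + 1 from rfl] at hz
  rw [hpCoeffTwo, hb, hz]
  have hpi : Real.pi ≠ 0 := Real.pi_ne_zero
  have hf : ((2 * m + 2)! : ℝ) = (2 * m + 2) * (2 * m + 1) * (2 * m)! := by
    rw [Nat.factorial_succ (2 * m + 1), Nat.factorial_succ (2 * m)]
    push_cast
    ring
  rw [hf]
  have hm1 : ((m : ℝ) + 1) ≠ 0 := by positivity
  have hfac : ((2 * m)! : ℝ) ≠ 0 := by positivity
  field_simp
  ring

/-! ## §2 at `n = 0`: both families give `8G` (kernel check of the two transcriptions) -/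

/-- Catalan's series regrouped in pairs: `Σ_{u ≥ 0} (1/(4u+1)² − 1/(4u+3)²) = G`. [folklore] -/
private theorem hasSum_catalan_pairs :
    HasSum (fun u : ℕ => 1 / (4 * (u : ℝ) + 1) ^ 2 - 1 / (4 * (u : ℝ) + 3) ^ 2) catalanConstant := by
  set f : ℕ → ℝ := fun n => (-1 : ℝ) ^ n / ((2 * n + 1 : ℝ)) ^ 2 with hf
  have hsum : Summable f := Literature.NumberTheory.Transcendental.summable_catalanConstant_series
  have hinj2 : Function.Injective fun k : ℕ => 2 * k := fun a b h => by simpa using h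
  have hinj2' : Function.Injective fun k : ℕ => 2 * k + 1 := fun a b h => by simpa using h
  have he : Summable fun k : ℕ => f (2 * k) := hsum.comp_injective hinj2
  have ho : Summable fun k : ℕ => f (2 * k + 1) := hsum.comp_injective hinj2'
  have hsplit : HasSum f (∑' k, f (2 * k) + ∑' k, f (2 * k + 1)) :=
    HasSum.even_add_odd he.hasSum ho.hasSum
  have hG : ∑' k, f (2 * k) + ∑' k, f (2 * k + 1) = catalanConstant :=
    hsplit.unique Literature.NumberTheory.Transcendental.hasSum_catalanConstant
  have hpair : HasSum (fun k : ℕ => f (2 * k) + f (2 * k + 1)) catalanConstant := by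
    rw [← hG]
    exact he.hasSum.add ho.hasSum
  refine hpair.congr_fun fun u => ?_
  simp only [hf, pow_mul, pow_succ, mul_neg, mul_one]
  push_cast
  rw [show (2 : ℝ) * (2 * u) + 1 = 4 * u + 1 by ring, show (2 : ℝ) * (2 * u + 1) + 1 = 4 * u + 3 by ring]
  ring

/-- `r̃_0 = 8G`: at `n = 0` the second family of §2 is `4 Σ_{u≥0} (2u+1)/((2u+½)²(2u+3/2)²)
= 8 Σ (1/(4u+1)² − 1/(4u+3)²) = 8G` — so `r_0 = r̃_0` (`catalanR_zero`) and the integrality claim hold at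
`n = 0` in the kernel. [cite: KrattenthalerZudilin2019, §2] -/
theorem catalanRTilde_zero : catalanRTilde 0 = 8 * catalanConstant := by
  rw [catalanRTilde, ← (hasSum_catalan_pairs.mul_left 8).tsum_eq, ← tsum_mul_left]
  refine tsum_congr fun u => ?_
  simp only [mul_zero, zero_add, Nat.factorial_one, Nat.cast_one, mul_one, prod_range_zero,
    Nat.cast_zero, sub_zero, prod_range_succ, prod_range_zero, one_mul, add_zero]
  have h1 : (4 * (u : ℝ) + 1) ≠ 0 := by positivity
  have h3 : (4 * (u : ℝ) + 3) ≠ 0 := by positivity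
  rw [show (2 * (u : ℝ) + 1 / 2) = (4 * u + 1) / 2 by ring,
    show ((4 * (u : ℝ) + 1) / 2 + 1) = (4 * u + 3) / 2 by ring]
  field_simp
  ring

/-- `r_0 = r̃_0` (the case `n = 0` of `catalanR_eq_catalanRTilde`, PROVED).
[cite: KrattenthalerZudilin2019, §2 ("r_n = r̃_n")] -/
theorem catalanR_eq_catalanRTilde_zero : catalanR 0 = catalanRTilde 0 := by
  rw [catalanR_zero, catalanRTilde_zero]

/-- The integrality claim of §2 at `n = 0`: `2^0 d_{−1}^2 r̃_0 = 0 + 8·G` (`d_{−1} = lcm(∅) = 1`).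
[cite: KrattenthalerZudilin2019, §2 (sentence after the second display)] -/
theorem catalanRTilde_integrality_zero :
    ∃ A B : ℤ, (2 : ℝ) ^ (4 * 0) * (Nat.lcmUpto (2 * 0 - 1) : ℝ) ^ 2 * catalanRTilde 0 =
      A + B * catalanConstant := by
  refine ⟨0, 8, ?_⟩
  rw [catalanRTilde_zero]
  simp [Nat.lcmUpto]

end Literature.NumberTheory.Irrationality.KrattenthalerZudilin2019
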